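import Literature.AlgebraicGeometry.HodgeTheory.NodalPencilModelIsotopy
import Literature.Geometry.ComplexAnalytic.PhamBrieskornJoinBounded
import HarnessLib

/-!
# The local Milnor fibre of a pencil member near an ordinary double point: a homeomorphism onto a cut `A₁` fibre,
# injective on homology

Family `hodge`, layer `Literature/AlgebraicGeometry/HodgeTheory`. Written by the prover seat `hodge-nonav-prover-Bx` (g15, cell
`hodge-nonav`) as a brick of the ODP-ISOTOPY port (memo `PROGRAMME-ODP-ISOTOPY-Bx-g13` §2; Picard–Lefschetz binder hPL₁
`picardLefschetz_oneNode` of crux K1-B, stmt-HodgeConjecture-19716): the generalisation of prover-Ax's `CyclicCoverPencilLocalFibre`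
(step A4a for the quaternary cyclic pencil `x₃^p = f₁ + c·x₂^p`, weights `(2, 2, p)`) to an ARBITRARY degree `d ≥ 1`, `n + 2` variables,
chart `xᵢ ≠ 0`, monomial pencil direction `xᵢ^d` and an ORDINARY DOUBLE POINT (all weights `2`). For a member
`X_c = {Q ∈ S | c(Q) = c}` (`pencilFibre n d i b₀ c`, `c ≠ 0` small) of the pencil read in the regular locus `𝒴°(ℂ)`, and the part
`A = X_c ∩ {F < T'}` of it inside the Morse ball (`F` the saturated Morse radius of the Morse chart `Θ`, `Σⱼ (Θ y)ⱼ² = φ(y)`), the map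

  `e : A → F = {Σ zⱼ² = 1}`,  `e(Q)ⱼ = Θ(y(Q))ⱼ / λⱼ`  (`λⱼ² = c`)

(Morse coordinates followed by the rescaling of the local Milnor fibre `{Σ wⱼ² = c}` to `{Σ zⱼ² = 1}`) is a HOMEOMORPHISM onto the cut
fibre `F ∩ E`, `E = {Σ |λⱼ|² |zⱼ|² < T'}` (inverse: `z ↦ Φ⁻¹(b'₀, Θ⁻¹(λ z))`, a point of `𝒴°(ℂ)` because the member `b₀ + c·e_{xᵢ^d}` is
nonsingular), and `E` is a coordinatewise-monotone neighbourhood of Milnor's join when `Σ |λⱼ|² < T'`; so by `PhamBrieskornJoinBounded`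
(`F ∩ E ↪ F` is an isomorphism on homology) **`e` followed by the inclusion is injective on `H_k(·; ℚ)` for every `k`** — the input
`hinj` of `PicardLefschetzOfPencilIsotopy.exists_isPicardLefschetzData_one_of_pencilIsotopy`. Milnor §9 (the local fibre is the
Pham–Brieskorn fibre up to rescaling), AGZV II Part I §2.1.

* `pencilFibre`, `mem_pencilFibre_iff`, `mem_pencilFibre_iff_regCoeff_eq`;
* `localFibre_point`, `localFibre_mem`, `localFibre_smul_mem_target`, `localFibre_inv_affine`, `localFibre_inv_mem_target`,
  `localFibre_inv_spec`, `localFibre_inv_apply`;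
* `exists_localFibreChart` — the map `e : C(A, F)` with its formula and the injectivity on `H_k(·; ℚ)`.

Everything is proved; one concrete definition (`pencilFibre`); no named facts. Honest scope: plumbing of the classical construction of
the geometric monodromy of a pencil near an ordinary double point; nothing here says HC or any rung is proved.

## References

* [Milnor1968] J. Milnor, Singular Points of Complex Hypersurfaces, §9 Lemma 9.2, Lemma 9.4, Thm. 9.1.
* [ArnoldGuseinzadeVarchenko2012] V. I. Arnold, S. M. Gusein-Zade, A. N. Varchenko, Singularities of Differentiable Maps II (2012),
  Part I §2.1.
-/

noncomputable section

open CategoryTheory AlgebraicGeometry MvPolynomial TopologicalSpace Set Topology Filter Complex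
open scoped Manifold ContDiff Real
open Literature.AlgebraicGeometry.Motives Literature.AlgebraicGeometry.Motives.UniversalHypersurface
open Literature.AlgebraicGeometry.HodgeTheory.UniversalHypersurface Literature.Geometry.ComplexAnalytic
open Literature.AlgebraicTopology.SingularHomology

namespace Literature.AlgebraicGeometry.HodgeTheory

namespace NodalPencil

/-- **The member `X_c` of the pencil read in the regular locus**: the points of the pencil slice with pencil coordinate `c`.
[cite: ArnoldGuseinzadeVarchenko2012, Part I §2.1] -/
def pencilFibre (n d : ℕ) (i : Fin (n + 2)) (b₀ : DegIndex n d → ℂ) (c : ℂ) : Set (ComplexPoints (regularTotal ℂ n d)) :=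
  {Q | Q ∈ pencilSlice n d i b₀ ∧ pencilCoord n d i b₀ Q = c}

/-- Membership in `X_c`, unfolded. [cite: ArnoldGuseinzadeVarchenko2012, Part I §2.1] -/
theorem mem_pencilFibre_iff (n d : ℕ) (i : Fin (n + 2)) (b₀ : DegIndex n d → ℂ) (c : ℂ) (Q : ComplexPoints (regularTotal ℂ n d)) :
    Q ∈ pencilFibre n d i b₀ c ↔ Q ∈ pencilSlice n d i b₀ ∧ pencilCoord n d i b₀ Q = c :=
  Iff.rfl

/-- **`X_c` is the set of points with coefficient vector `b₀ + c·e_{xᵢ^d}`.** [cite: ArnoldGuseinzadeVarchenko2012, Part I §2.1] -/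
theorem mem_pencilFibre_iff_regCoeff_eq {n d : ℕ} {i : Fin (n + 2)} (b₀ : DegIndex n d → ℂ) (c : ℂ)
    (Q : ComplexPoints (regularTotal ℂ n d)) :
    Q ∈ pencilFibre n d i b₀ c ↔ regCoeff ℂ n d Q = b₀ + Pi.single (regPowIndex n d i) c := by
  constructor
  · rintro ⟨hS, hc⟩
    rw [regCoeff_eq_add_single_pencilCoord n d i b₀ hS, hc]
  · intro h
    have hS : Q ∈ pencilSlice n d i b₀ := fun m => by
      rw [h, Pi.add_apply, Pi.single_eq_of_ne m.2, add_zero]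
    refine ⟨hS, ?_⟩
    have h1 := congrFun (regCoeff_eq_add_single_pencilCoord n d i b₀ hS) (regPowIndex n d i)
    rw [h, Pi.add_apply, Pi.add_apply, Pi.single_eq_same, Pi.single_eq_same] at h1
    exact (add_left_cancel h1).symm

section LocalFibre

variable {n d : ℕ} {i : Fin (n + 2)} (hd : 0 < d) (b₀ : DegIndex n d → ℂ)
  (Φ : OpenPartialHomeomorph (ComplexPoints (regularTotal ℂ n d)) (({m : DegIndex n d // m ≠ regPowIndex n d i} ⊕ Fin (n + 1)) → ℂ))
  (hΦ : ⇑Φ = regChartFun n d i) (hΦs : Φ.source = regChartDom n d i) (hΦt : Φ.target = regChartFun n d i '' regChartDom n d i)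
  (Θ : OpenPartialHomeomorph (Fin (n + 1) → ℂ) (Fin (n + 1) → ℂ)) {r R''' R'' : ℝ}
  (hr : {z : Fin (n + 1) → ℂ | ∑ j, ‖z j‖ ^ 2 ≤ r ^ 2} ⊆ Θ.target)
  (φ : (Fin (n + 1) → ℂ) → ℂ)
  (hφ : ∀ y, φ y = regChartCoeffVec n d i
    (Sum.elim (fun m : {m : DegIndex n d // m ≠ regPowIndex n d i} => b₀ m.1) y) (regPowIndex n d i) - b₀ (regPowIndex n d i))
  (hΘφ : ∀ y ∈ Θ.source, ∑ j, (Θ y j) ^ 2 = φ y)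
  {ρW : ℝ}
  (hns : ∀ c : ℂ, c ≠ 0 → ‖c‖ < ρW →
    SmoothHypersurface.IsNonsingularForm ℂ (formOfCoeffs (b₀ + Pi.single (regPowIndex n d i) c)))
  (hR : R''' < R'') {T' : ℝ} (hT'R : T' ≤ R''') (hT'r : T' ≤ r ^ 2)
  {c : ℂ} (hc0 : c ≠ 0) (hcρ : ‖c‖ < ρW)
  (lam : Fin (n + 1) → ℂ) (hlam : ∀ j, lam j ^ 2 = c)
include hd hΦ hΦs hΦt hr hφ hΘφ hns hR hT'R hT'r hc0 hcρ hlam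

omit hd hΦ hΦs hΦt hr hφ hΘφ hns hR hT'R hT'r hc0 hcρ hlam in
/-- The rescaling constants are non-zero. [cite: Milnor1968, §9 Lemma 9.4] -/
theorem localFibre_lam_ne_zero (hc0 : c ≠ 0) (hlam : ∀ j, lam j ^ 2 = c) (j : Fin (n + 1)) : lam j ≠ 0 := by
  intro h
  have := hlam j
  rw [h, zero_pow two_ne_zero] at this
  exact hc0 this.symm

omit hd hΦ hΦt hr hns hT'r hc0 hcρ hlam in
/-- **Data of a point of `A = X_c ∩ {F < T'}`**: it lies in the chart domain, its affine coordinates `y` are in `Θ.source`,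
`Σ|Θ y|² = F`, and `Σ (Θ y)ⱼ² = c`. [cite: Milnor1968, §9 Lemma 9.4] [cite: ArnoldGuseinzadeVarchenko2012, Part I §2.1] -/
theorem localFibre_point {Q : ComplexPoints (regularTotal ℂ n d)} (hQ : Q ∈ pencilFibre n d i b₀ c)
    (hF : satRadius n d i Θ R''' R'' Q < T') :
    Q ∈ Φ.source ∧ (fun j => regChartFun n d i Q (Sum.inr j)) ∈ Θ.source ∧
      ∑ j, ‖Θ (fun j => regChartFun n d i Q (Sum.inr j)) j‖ ^ 2 = satRadius n d i Θ R''' R'' Q ∧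
      ∑ j, (Θ (fun j => regChartFun n d i Q (Sum.inr j))) j ^ 2 = c := by
  obtain ⟨hQd, hy, hSig⟩ := mem_of_satRadius_lt n d i Θ R''' R'' hR (lt_of_lt_of_le hF hT'R)
  refine ⟨hΦs ▸ hQd, hy, hSig, ?_⟩
  rw [hΘφ _ hy, ← hQ.2, pencilCoord_eq_phi n d i b₀ φ hφ hQd hQ.1]

omit hd hΦ hΦt hr hns hT'r hcρ in
/-- **`e(Q) = (Θ(y(Q))ⱼ / λⱼ)ⱼ` lies in the cut fibre `F ∩ {Σ|λⱼ|²|zⱼ|² < T'}`.** [cite: Milnor1968, §9 Lemma 9.4 and Thm. 9.1] -/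
theorem localFibre_mem {Q : ComplexPoints (regularTotal ℂ n d)} (hQ : Q ∈ pencilFibre n d i b₀ c)
    (hF : satRadius n d i Θ R''' R'' Q < T') :
    (fun j => Θ (fun j => regChartFun n d i Q (Sum.inr j)) j / lam j) ∈
      PhamBrieskorn.fibre (fun _ : Fin (n + 1) => 2) ∩ {z : Fin (n + 1) → ℂ | ∑ j, ‖lam j‖ ^ 2 * ‖z j‖ ^ 2 < T'} := by
  obtain ⟨-, -, hSig, hsum⟩ := localFibre_point b₀ Φ hΦs Θ φ hφ hΘφ hR hT'R hQ hF
  have hl0 := localFibre_lam_ne_zero lam hc0 hlam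
  constructor
  · rw [PhamBrieskorn.mem_fibre]
    have h : ∀ j, (Θ (fun j => regChartFun n d i Q (Sum.inr j)) j / lam j) ^ (fun _ : Fin (n + 1) => 2) j =
        (Θ (fun j => regChartFun n d i Q (Sum.inr j))) j ^ 2 / c := fun j => by
      change (_ / _) ^ 2 = _
      rw [div_pow, hlam j]
    simp_rw [h, ← Finset.sum_div, hsum, div_self hc0]
  · show ∑ j, ‖lam j‖ ^ 2 * ‖Θ (fun j => regChartFun n d i Q (Sum.inr j)) j / lam j‖ ^ 2 < T'
    have h : ∀ j, ‖lam j‖ ^ 2 * ‖Θ (fun j => regChartFun n d i Q (Sum.inr j)) j / lam j‖ ^ 2 =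
        ‖Θ (fun j => regChartFun n d i Q (Sum.inr j)) j‖ ^ 2 := fun j => by
      rw [norm_div, div_pow, ← mul_div_assoc, mul_div_cancel_left₀ _ (pow_ne_zero 2 (norm_ne_zero_iff.mpr (hl0 j)))]
    simp_rw [h, hSig]; exact hF

/-! ### The inverse `z ↦ Φ⁻¹(b'₀, Θ⁻¹(λ z))` -/

omit hd hΦ hΦs hΦt hφ hΘφ hns hR hT'R hc0 hcρ hlam in
/-- For `z` in the cut, `λ z` lies in the chart ball `{Σ|w|² < T'} ⊆ Θ.target`. [cite: Milnor1968, §9 Lemma 9.4] -/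
theorem localFibre_smul_mem_target {z : Fin (n + 1) → ℂ}
    (hz : z ∈ {z : Fin (n + 1) → ℂ | ∑ j, ‖lam j‖ ^ 2 * ‖z j‖ ^ 2 < T'}) :
    ∑ j, ‖(lam * z) j‖ ^ 2 < T' ∧ lam * z ∈ Θ.target := by
  have h : ∑ j, ‖(lam * z) j‖ ^ 2 = ∑ j, ‖lam j‖ ^ 2 * ‖z j‖ ^ 2 :=
    Finset.sum_congr rfl fun j _ => by rw [Pi.mul_apply, norm_mul, mul_pow]
  refine ⟨h ▸ hz, hr ?_⟩
  show ∑ j, ‖(lam * z) j‖ ^ 2 ≤ r ^ 2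
  rw [h]; exact (le_of_lt hz).trans hT'r

omit hd hΦ hΦs hΦt hφ hns hR hT'R hc0 hcρ in
/-- **The affine point `y' = Θ⁻¹(λ z)` of a point `z` of the cut fibre**: `y' ∈ Θ.source`, `Θ y' = λ z`, `φ(y') = c`,
`Σ|Θ y'|² = Σ|λⱼ|²|zⱼ|²`. [cite: Milnor1968, §9 Lemma 9.4] -/
theorem localFibre_inv_affine {z : Fin (n + 1) → ℂ}
    (hz : z ∈ PhamBrieskorn.fibre (fun _ : Fin (n + 1) => 2) ∩ {z : Fin (n + 1) → ℂ | ∑ j, ‖lam j‖ ^ 2 * ‖z j‖ ^ 2 < T'}) :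
    Θ.symm (lam * z) ∈ Θ.source ∧ Θ (Θ.symm (lam * z)) = lam * z ∧ φ (Θ.symm (lam * z)) = c ∧
      ∑ j, ‖Θ (Θ.symm (lam * z)) j‖ ^ 2 = ∑ j, ‖lam j‖ ^ 2 * ‖z j‖ ^ 2 := by
  obtain ⟨-, ht⟩ := localFibre_smul_mem_target Θ hr hT'r lam hz.2
  have hy : Θ.symm (lam * z) ∈ Θ.source := Θ.map_target ht
  have hΘy : Θ (Θ.symm (lam * z)) = lam * z := Θ.right_inv ht
  refine ⟨hy, hΘy, ?_, ?_⟩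
  · rw [← hΘφ _ hy, hΘy]
    have h : ∀ j, (lam * z) j ^ 2 = c * z j ^ (fun _ : Fin (n + 1) => 2) j :=
      fun j => by rw [Pi.mul_apply, mul_pow, hlam j]
    simp_rw [h, ← Finset.mul_sum, PhamBrieskorn.mem_fibre.mp hz.1, mul_one]
  · rw [hΘy]
    exact Finset.sum_congr rfl fun j _ => by rw [Pi.mul_apply, norm_mul, mul_pow]

omit hΦ hΦs hR hT'R in
/-- **The coordinate vector `(b'₀, Θ⁻¹(λ z))` lies in `Φ.target`**: the solved form there is the member `b₀ + c·e_{xᵢ^d}`, nonsingular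
for `0 < |c| < ρW`. [cite: Milnor1968, §9 Lemma 9.4] -/
theorem localFibre_inv_mem_target {z : Fin (n + 1) → ℂ}
    (hz : z ∈ PhamBrieskorn.fibre (fun _ : Fin (n + 1) => 2) ∩ {z : Fin (n + 1) → ℂ | ∑ j, ‖lam j‖ ^ 2 * ‖z j‖ ^ 2 < T'}) :
    (Sum.elim (fun m : {m : DegIndex n d // m ≠ regPowIndex n d i} => b₀ m.1) (Θ.symm (lam * z)) :
      ({m : DegIndex n d // m ≠ regPowIndex n d i} ⊕ Fin (n + 1)) → ℂ) ∈ Φ.target := by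
  obtain ⟨-, -, hφc, -⟩ := localFibre_inv_affine Θ hr φ hΘφ hT'r lam hlam hz
  rw [hΦt]
  refine mem_image_regChartFun_of_nonsingular n d i hd _ ?_
  rw [regChartCoeffVec_slice_eq b₀ φ hφ, hφc]
  exact hns c hc0 hcρ

omit hT'R in
/-- **The inverse point `Q(z) = Φ⁻¹(b'₀, Θ⁻¹(λ z))`**: it lies in `Φ.source` with chart coordinates `(b'₀, Θ⁻¹(λ z))`, belongs to
`X_c`, has `F(Q(z)) = Σ|λⱼ|²|zⱼ|² < T'`, and `e(Q(z)) = z`. [cite: Milnor1968, §9 Lemma 9.4] -/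
theorem localFibre_inv_spec (hT'R : T' ≤ R''') {z : Fin (n + 1) → ℂ}
    (hz : z ∈ PhamBrieskorn.fibre (fun _ : Fin (n + 1) => 2) ∩ {z : Fin (n + 1) → ℂ | ∑ j, ‖lam j‖ ^ 2 * ‖z j‖ ^ 2 < T'}) :
    Φ.symm (Sum.elim (fun m : {m : DegIndex n d // m ≠ regPowIndex n d i} => b₀ m.1) (Θ.symm (lam * z))) ∈ Φ.source ∧
      regChartFun n d i (Φ.symm (Sum.elim (fun m : {m : DegIndex n d // m ≠ regPowIndex n d i} => b₀ m.1)
        (Θ.symm (lam * z)))) =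
        Sum.elim (fun m : {m : DegIndex n d // m ≠ regPowIndex n d i} => b₀ m.1) (Θ.symm (lam * z)) ∧
      Φ.symm (Sum.elim (fun m : {m : DegIndex n d // m ≠ regPowIndex n d i} => b₀ m.1) (Θ.symm (lam * z))) ∈
        pencilFibre n d i b₀ c ∧
      satRadius n d i Θ R''' R'' (Φ.symm (Sum.elim (fun m : {m : DegIndex n d // m ≠ regPowIndex n d i} => b₀ m.1)
        (Θ.symm (lam * z)))) = ∑ j, ‖lam j‖ ^ 2 * ‖z j‖ ^ 2 ∧
      (fun j => Θ (fun j => regChartFun n d i (Φ.symm (Sum.elim (fun m : {m : DegIndex n d // m ≠ regPowIndex n d i} => b₀ m.1)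
        (Θ.symm (lam * z)))) (Sum.inr j)) j / lam j) = z := by
  set v : ({m : DegIndex n d // m ≠ regPowIndex n d i} ⊕ Fin (n + 1)) → ℂ :=
    Sum.elim (fun m : {m : DegIndex n d // m ≠ regPowIndex n d i} => b₀ m.1) (Θ.symm (lam * z)) with hv
  have hvt : v ∈ Φ.target := localFibre_inv_mem_target hd b₀ Φ hΦt Θ hr φ hφ hΘφ hns hT'r hc0 hcρ lam hlam hz
  obtain ⟨hy, hΘy, hφc, hSig⟩ := localFibre_inv_affine Θ hr φ hΘφ hT'r lam hlam hz
  have hsrc : Φ.symm v ∈ Φ.source := Φ.map_target hvt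
  have hchart : regChartFun n d i (Φ.symm v) = v := by rw [← hΦ]; exact Φ.right_inv hvt
  have hdom : Φ.symm v ∈ regChartDom n d i := hΦs ▸ hsrc
  have haff : (fun j => regChartFun n d i (Φ.symm v) (Sum.inr j)) = Θ.symm (lam * z) := by
    funext j; rw [hchart]; rfl
  have hcoeff : regCoeff ℂ n d (Φ.symm v) = b₀ + Pi.single (regPowIndex n d i) c := by
    rw [regCoeff_eq_regChartCoeffVec n d i hdom, hchart, hv, regChartCoeffVec_slice_eq b₀ φ hφ, hφc]
  have hmem : Φ.symm v ∈ pencilFibre n d i b₀ c := (mem_pencilFibre_iff_regCoeff_eq b₀ c _).mpr hcoeff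
  have hlt : ∑ j, ‖lam j‖ ^ 2 * ‖z j‖ ^ 2 < T' := hz.2
  refine ⟨hsrc, hchart, hmem, ?_, ?_⟩
  · rw [satRadius_eq_of_le n d i Θ R''' R'' hR hdom (haff ▸ hy) (by rw [haff, hSig]; exact hlt.le.trans hT'R), haff, hSig]
  · funext j
    rw [haff, hΘy, Pi.mul_apply, mul_div_cancel_left₀ _ (localFibre_lam_ne_zero lam hc0 hlam j)]

omit hd hΦt hr hns hT'r hcρ in
/-- **Left inverse**: `Q(e(Q)) = Q` for `Q ∈ A`. [cite: Milnor1968, §9 Lemma 9.4] -/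
theorem localFibre_inv_apply {Q : ComplexPoints (regularTotal ℂ n d)} (hQ : Q ∈ pencilFibre n d i b₀ c)
    (hF : satRadius n d i Θ R''' R'' Q < T') :
    Φ.symm (Sum.elim (fun m : {m : DegIndex n d // m ≠ regPowIndex n d i} => b₀ m.1)
        (Θ.symm (lam * fun j => Θ (fun j => regChartFun n d i Q (Sum.inr j)) j / lam j))) = Q := by
  obtain ⟨hQs, hy, -, -⟩ := localFibre_point b₀ Φ hΦs Θ φ hφ hΘφ hR hT'R hQ hF
  have hl0 := localFibre_lam_ne_zero lam hc0 hlam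
  have hmul : (lam * fun j => Θ (fun j => regChartFun n d i Q (Sum.inr j)) j / lam j) =
      Θ (fun j => regChartFun n d i Q (Sum.inr j)) := by
    funext j; rw [Pi.mul_apply, mul_div_cancel₀ _ (hl0 j)]
  rw [hmul, Θ.left_inv hy]
  have hv : (Sum.elim (fun m : {m : DegIndex n d // m ≠ regPowIndex n d i} => b₀ m.1)
        (fun j => regChartFun n d i Q (Sum.inr j)) :
      ({m : DegIndex n d // m ≠ regPowIndex n d i} ⊕ Fin (n + 1)) → ℂ) = Φ Q := by
    funext s
    rcases s with m | j
    · rw [Sum.elim_inl, hΦ]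
      have h := congrFun (regCoeff_eq_regChartCoeffVec n d i (hΦs ▸ hQs)) m.1
      rw [hQ.1 m, regChartCoeffVec_of_ne n d i _ m.2] at h
      exact h
    · rw [Sum.elim_inr, hΦ]
  rw [hv, Φ.left_inv hQs]

/-! ### The local fibre chart -/

/-- **The local Milnor fibre chart at an ordinary double point.** For `0 < |c| < ρW`, `λⱼ² = c` with `Σ|λⱼ|² < T'`
(`T' ≤ min(R''', r²)`), there is a continuous map `e : A → F` from `A = X_c ∩ {F < T'}` to the `A₁` fibre `F = {Σ zⱼ² = 1}`, given
by `e(Q)ⱼ = Θ(y(Q))ⱼ / λⱼ`, which is **injective on `H_k(·; ℚ)` for every `k`** (a homeomorphism onto the cut fibre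
`F ∩ {Σ|λⱼ|²|zⱼ|² < T'}`, whose inclusion in `F` is a homology isomorphism since the cut contains Milnor's join).
[cite: Milnor1968, §9 Lemma 9.2, Lemma 9.4, Thm. 9.1] [cite: ArnoldGuseinzadeVarchenko2012, Part I §2.1] -/
theorem exists_localFibreChart (hΘc : ContinuousOn Θ Θ.source) (hlamT : ∑ j, ‖lam j‖ ^ 2 < T') :
    ∃ e : C(↥{Q : ↥(pencilFibre n d i b₀ c) | satRadius n d i Θ R''' R'' Q.1 < T'},
        ↥(PhamBrieskorn.fibre (fun _ : Fin (n + 1) => (2 : ℕ)))),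
      (∀ k, Function.Injective (singularHomology.map ℚ ℚ e k).hom) ∧
      ∀ Q, (e Q : Fin (n + 1) → ℂ) = fun j => Θ (fun j => regChartFun n d i Q.1.1 (Sum.inr j)) j / lam j := by
  set a : Fin (n + 1) → ℕ := fun _ => 2 with ha_def
  have ha : ∀ j, a j ≠ 0 := fun _ => two_ne_zero
  set E : Set (Fin (n + 1) → ℂ) := {z | ∑ j, ‖lam j‖ ^ 2 * ‖z j‖ ^ 2 < T'} with hE_def
  set A : Set ↥(pencilFibre n d i b₀ c) := {Q | satRadius n d i Θ R''' R'' Q.1 < T'} with hA_def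
  -- the forward map onto the cut fibre
  let e₀ : ↥A → ↥(PhamBrieskorn.fibre a ∩ E) := fun Q =>
    ⟨fun j => Θ (fun j => regChartFun n d i Q.1.1 (Sum.inr j)) j / lam j,
      localFibre_mem b₀ Φ hΦs Θ φ hφ hΘφ hR hT'R hc0 lam hlam Q.1.2 Q.2⟩
  have he₀c : Continuous e₀ := by
    refine Continuous.subtype_mk (continuous_pi fun j => Continuous.div_const ?_ _) _
    have hval : Continuous fun Q : ↥A => (Q.1.1 : ComplexPoints (regularTotal ℂ n d)) :=
      continuous_subtype_val.comp continuous_subtype_val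
    have hy : Continuous fun Q : ↥A => fun j => regChartFun n d i Q.1.1 (Sum.inr j) := by
      have h1 : ContinuousOn (fun x : ComplexPoints (regularTotal ℂ n d) => fun j => Φ x (Sum.inr j)) Φ.source :=
        (continuous_pi fun j => continuous_apply (Sum.inr j)).comp_continuousOn Φ.continuousOn
      have h2 := h1.comp_continuous hval fun Q => (localFibre_point b₀ Φ hΦs Θ φ hφ hΘφ hR hT'R Q.1.2 Q.2).1
      rw [hΦ] at h2; exact h2
    have hΘy := hΘc.comp_continuous hy fun Q => (localFibre_point b₀ Φ hΦs Θ φ hφ hΘφ hR hT'R Q.1.2 Q.2).2.1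
    exact (continuous_apply j).comp hΘy
  -- the inverse
  let g₀ : ↥(PhamBrieskorn.fibre a ∩ E) → ↥A := fun z =>
    ⟨⟨Φ.symm (Sum.elim (fun m : {m : DegIndex n d // m ≠ regPowIndex n d i} => b₀ m.1) (Θ.symm (lam * z.1))),
        (localFibre_inv_spec hd b₀ Φ hΦ hΦs hΦt Θ hr φ hφ hΘφ hns hR hT'r hc0 hcρ lam hlam hT'R z.2).2.2.1⟩,
      by
        show satRadius n d i Θ R''' R'' _ < T'
        rw [(localFibre_inv_spec hd b₀ Φ hΦ hΦs hΦt Θ hr φ hφ hΘφ hns hR hT'r hc0 hcρ lam hlam hT'R z.2).2.2.2.1]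
        exact z.2.2⟩
  have hg₀c : Continuous g₀ := by
    refine Continuous.subtype_mk (Continuous.subtype_mk ?_ _) _
    have hz : Continuous fun z : ↥(PhamBrieskorn.fibre a ∩ E) => lam * z.1 := continuous_const.mul continuous_subtype_val
    have hΘs : Continuous fun z : ↥(PhamBrieskorn.fibre a ∩ E) => Θ.symm (lam * z.1) :=
      Θ.continuousOn_symm.comp_continuous hz fun z => (localFibre_smul_mem_target Θ hr hT'r lam z.2.2).2
    have hv : Continuous fun z : ↥(PhamBrieskorn.fibre a ∩ E) =>
        (Sum.elim (fun m : {m : DegIndex n d // m ≠ regPowIndex n d i} => b₀ m.1) (Θ.symm (lam * z.1)) :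
          ({m : DegIndex n d // m ≠ regPowIndex n d i} ⊕ Fin (n + 1)) → ℂ) := by
      refine continuous_pi fun s => ?_
      rcases s with m | j
      · exact continuous_const
      · exact (continuous_apply j).comp hΘs
    exact Φ.continuousOn_symm.comp_continuous hv fun z =>
      localFibre_inv_mem_target hd b₀ Φ hΦt Θ hr φ hφ hΘφ hns hT'r hc0 hcρ lam hlam z.2
  -- the homeomorphism `A ≃ₜ F ∩ E`
  let η : ↥A ≃ₜ ↥(PhamBrieskorn.fibre a ∩ E) :=
    { toFun := e₀
      invFun := g₀
      left_inv := fun Q => Subtype.ext (Subtype.ext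
        (localFibre_inv_apply b₀ Φ hΦ hΦs Θ φ hφ hΘφ hR hT'R hc0 lam hlam Q.1.2 Q.2))
      right_inv := fun z => Subtype.ext
        (localFibre_inv_spec hd b₀ Φ hΦ hΦs hΦt Θ hr φ hφ hΘφ hns hR hT'r hc0 hcρ lam hlam hT'R z.2).2.2.2.2
      continuous_toFun := he₀c
      continuous_invFun := hg₀c }
  let ι : C(↥(PhamBrieskorn.fibre a ∩ E), ↥(PhamBrieskorn.fibre a)) :=
    ⟨Set.inclusion (Set.inter_subset_left : PhamBrieskorn.fibre a ∩ E ⊆ PhamBrieskorn.fibre a), continuous_inclusion _⟩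
  refine ⟨ι.comp (η : C(↥A, ↥(PhamBrieskorn.fibre a ∩ E))), fun k => ?_, fun Q => rfl⟩
  -- injectivity on `H_k`: `ι_*` is bijective (the cut contains the join), `η_*` is an isomorphism
  have hE : ∀ z ∈ E, ∀ w : Fin (n + 1) → ℂ, (∀ j, ‖w j‖ ≤ ‖z j‖) → w ∈ E := by
    intro z hz w hw
    show ∑ j, ‖lam j‖ ^ 2 * ‖w j‖ ^ 2 < T'
    refine lt_of_le_of_lt (Finset.sum_le_sum fun j _ => ?_) hz
    exact mul_le_mul_of_nonneg_left (pow_le_pow_left₀ (norm_nonneg _) (hw j) 2) (sq_nonneg _)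
  have hJE : PhamBrieskorn.join a ⊆ E :=
    PhamBrieskorn.join_subset_of_sum_lt ha (lam := fun j => ‖lam j‖ ^ 2) (fun j => sq_nonneg _) hlamT
  have hι := PhamBrieskorn.bijective_map_inclusion_fibre_inter a ℚ ℚ ha hE hJE k
  have hη : Function.Bijective (singularHomology.map ℚ ℚ (η : C(↥A, ↥(PhamBrieskorn.fibre a ∩ E))) k).hom :=
    (singularHomology.mapIso ℚ ℚ η k).toLinearEquiv.bijective
  rw [singularHomology.map_comp]
  exact hι.1.comp hη.1

end LocalFibre

end NodalPencil

end Literature.AlgebraicGeometry.HodgeTheory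

end
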